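import Summits.ResolutionOfSingularities.ResolutionOfSingularities.Theorems.WeightedInvariantIota3EpsStrat
import HarnessLib

/-!
# The top `(ν ; ε)`-stratum at every P3 position is a permissible centre: `topStratum iotaOrdEps S f = V(P)`,
# `topStratumPrime iotaOrdEps S f = P` prime with `S ⧸ P` regular and `f ∈ P ^ ν`
# (door `HypersurfaceCentreConstruction`, stmt-ResolutionOfSingularities-19897, route `WeightedInvariant`, rung P3)

[OURS · L1 W4.3 · cell `res-hironaka`, HUMAN RULING D-0089] Helper file `--supports stmt-ResolutionOfSingularities-19897`
(res-type-078 g13; IOTA3-DESIGN v1 §2.2 «CERTIFICATE USE» / §2.3 generic reading; sequel to `…Iota3EpsStrat`).  Replaces the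
role of NO printed item; NOT a statement of the manuscript under review [claim: Hironaka2017, status: under-review].  AI work,
weaker than expert review.  Def-free.

The (strat) certificate `Iota3.strat_iotaOrdEps_of_ringKrullDim_le_three` is repackaged in the `ContactCylinder.topStratum /
topStratumPrime` language of res-type-005 (p524206) that the cylinder combinators `jCylinder` (005) and `iotaCylinder` (061,
(o32-ι-c)) consume as HYPOTHESES («`topStratumPrime ι R f = P`, `P` prime, `R ⧸ P` regular»):

* `topStratum_iotaOrdEps_eq` — at a P3 position (`S` regular local, `dim S ≤ 3`, `0 ≠ f ∈ 𝔪`) there is a prime `P ∋ f` with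
  `S ⧸ P` regular and `topStratum iotaOrdEps S f = {𝔮 | P ≤ 𝔮}`;
* `topStratumPrime_iotaOrdEps_spec` — hence `P₀ := topStratumPrime iotaOrdEps S f` is PRIME, `S ⧸ P₀` is a regular local ring,
  `f ∈ P₀`, `topStratum iotaOrdEps S f = V(P₀)`, and the order of `f` is KEPT along `V(P₀)` with `f ∈ P₀ ^ ν` (`ν = ord f`;
  res-type-078 p524107 `EquimultipleCentre.mem_pow_of_iotaOrd_localization_eq`) — the (adm) input along the centre;
* `ringKrullDim_quotient_topStratumPrime_le_one`-type facts are NOT here (the curve/point dichotomy is read off `P₀ = 𝔪` or not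
  by the consumer).

## References

* res-type-005 `…ContactCylinderDefs` (p524206); res-type-013 `…Iota3Eps` (p527087); res-type-078 `…Iota3EpsStrat`,
  `…IotaOrderEquimultipleCentre` (p524107); res-L1-w43-plan-1 IOTA3-DESIGN v1 (OURS, AI planning).
-/

noncomputable section

open IsLocalRing Literature.AlgebraicGeometry.Resolution

set_option linter.dupNamespace false -- mandated namespace of this single-conjunct summit

namespace Summit.ResolutionOfSingularities.ResolutionOfSingularities.Cruxes.HypersurfaceCentreConstruction.LocalEngine

namespace Iota3

open Summit.ResolutionOfSingularities.ResolutionOfSingularities.Theorems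

variable {S : Type} [CommRing S]

/-- If the pair `(ν, ε)` of a NON-UNIT `f` is kept at a prime `𝔮`, then `f ∈ 𝔮` (the order is kept, and a non-unit has
positive order). [OURS] -/
theorem mem_asIdeal_of_mem_topStratum_iotaOrdEps [IsLocalRing S] {f : S} (hf : f ∈ maximalIdeal S)
    {𝔮 : PrimeSpectrum S} (h𝔮 : 𝔮 ∈ ContactCylinder.topStratum iotaOrdEps S f) : f ∈ 𝔮.asIdeal := by
  rw [ContactCylinder.mem_topStratum_iff, iotaOrdEps_eq_iff] at h𝔮
  exact mem_asIdeal_of_mem_topStratum_iotaOrd S hf ((ContactCylinder.mem_topStratum_iff iotaOrd S f 𝔮).mpr h𝔮.1)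

/-- **The top `(ν ; ε)`-stratum at a P3 position is a permissible centre**: for `S` regular local of Krull dimension ≤ 3 and
`0 ≠ f ∈ 𝔪` there is a prime `P ∋ f` with `S ⧸ P` regular and `topStratum iotaOrdEps S f = {𝔮 | P ≤ 𝔮}`.
[OURS · L1 W4.3, kernel] -/
theorem topStratum_iotaOrdEps_eq [IsRegularLocalRing S] (hdim : ringKrullDim S ≤ 3) {f : S} (hf0 : f ≠ 0)
    (hf : f ∈ maximalIdeal S) :
    ∃ P : Ideal S, P.IsPrime ∧ IsRegularLocalRing (S ⧸ P) ∧ f ∈ P ∧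
      ContactCylinder.topStratum iotaOrdEps S f = {𝔮 | P ≤ 𝔮.asIdeal} := by
  obtain ⟨P, hP, hreg, hfP, hiff⟩ := strat_iotaOrdEps_of_ringKrullDim_le_three hdim hf0 hf
  refine ⟨P, hP, hreg, hfP, Set.ext fun 𝔮 => ?_⟩
  simp only [Set.mem_setOf_eq]
  by_cases hf𝔮 : f ∈ 𝔮.asIdeal
  · rw [ContactCylinder.mem_topStratum_iff]
    exact hiff 𝔮.asIdeal hf𝔮
  · constructor
    · exact fun h => absurd (mem_asIdeal_of_mem_topStratum_iotaOrdEps hf h) hf𝔮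
    · exact fun h => absurd (h hfP) hf𝔮

/-- **The generic prime of the top `(ν ; ε)`-stratum at a P3 position**: `P₀ := topStratumPrime iotaOrdEps S f` is prime,
`S ⧸ P₀` is a regular local ring, `f ∈ P₀`, the stratum is `V(P₀)`, the pair `(ν, ε)` is kept exactly at the primes above
`P₀`, and `f ∈ P₀ ^ ν` (`ν = ord f`: the order is kept along `V(P₀)`, res-type-078 p524107).  These are the hypotheses the
cylinder combinators `jCylinder` (005) / `iotaCylinder` (061) take. [OURS · L1 W4.3, kernel] -/
theorem topStratumPrime_iotaOrdEps_spec [IsRegularLocalRing S] (hdim : ringKrullDim S ≤ 3) {f : S} (hf0 : f ≠ 0)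
    (hf : f ∈ maximalIdeal S) {ν : ℕ} (hν : iotaOrd S f = ν) :
    ∃ (_ : (ContactCylinder.topStratumPrime iotaOrdEps S f).IsPrime),
      IsRegularLocalRing (S ⧸ ContactCylinder.topStratumPrime iotaOrdEps S f) ∧
      f ∈ ContactCylinder.topStratumPrime iotaOrdEps S f ∧
      ContactCylinder.topStratum iotaOrdEps S f = {𝔮 | ContactCylinder.topStratumPrime iotaOrdEps S f ≤ 𝔮.asIdeal} ∧
      (∀ (𝔭 : Ideal S) [𝔭.IsPrime], f ∈ 𝔭 →
        (iotaOrdEps (Localization.AtPrime 𝔭) (algebraMap S (Localization.AtPrime 𝔭) f) = iotaOrdEps S f ↔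
          ContactCylinder.topStratumPrime iotaOrdEps S f ≤ 𝔭)) ∧
      f ∈ ContactCylinder.topStratumPrime iotaOrdEps S f ^ ν := by
  obtain ⟨P, hP, hreg, hfP, hS⟩ := topStratum_iotaOrdEps_eq hdim hf0 hf
  have hP₀ : ContactCylinder.topStratumPrime iotaOrdEps S f = P :=
    ContactCylinder.topStratumPrime_eq_of_topStratum_eq iotaOrdEps S f hS
  rw [hP₀]
  have hiff : ∀ (𝔭 : Ideal S) [𝔭.IsPrime], f ∈ 𝔭 →
      (iotaOrdEps (Localization.AtPrime 𝔭) (algebraMap S (Localization.AtPrime 𝔭) f) = iotaOrdEps S f ↔ P ≤ 𝔭) := by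
    intro 𝔭 _ _
    have := Set.ext_iff.mp hS ⟨𝔭, inferInstance⟩
    rwa [ContactCylinder.mem_topStratum_iff, Set.mem_setOf_eq] at this
  have hord : iotaOrd (Localization.AtPrime P) (algebraMap S (Localization.AtPrime P) f) = iotaOrd S f :=
    ((iotaOrdEps_eq_iff _ _ _ _).mp ((hiff P hfP).mpr le_rfl)).1
  haveI := hreg
  exact ⟨hP, hreg, hfP, hS, fun 𝔭 _ h => hiff 𝔭 h, EquimultipleCentre.mem_pow_of_iotaOrd_localization_eq P hν hord⟩

end Iota3

end Summit.ResolutionOfSingularities.ResolutionOfSingularities.Cruxes.HypersurfaceCentreConstruction.LocalEngine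

end
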